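import Literature.Geometry.Lorentzian.SpacelikeGraphDevelopment
import Literature.Geometry.Lorentzian.VacuumDataDominantEnergy
import HarnessLib

/-!
# The rigid positive energy theorem is verified on compactly supported spacelike graph data

`positive_mass_rigidity_spacetime` (Beig–Chruściel, J. Math. Phys. 37 (1996), Thm. 4.1 with
`m = 0`; `SpacetimePositiveMassRigidity.lean`) says: `3`-dimensional data satisfying the
dominant energy condition, asymptotically flat of order `1` with decaying sources on an end
which is the only end, and of ADM energy `0` there, have a Cauchy development which is
Minkowski space-time. The theorem asserts, in other words, that such data are slices of
Minkowski space-time; the zero-energy data one can write down are the compactly perturbed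
slices `t = u(x)`, `u ∈ C_c^∞(ℝ³)`, `‖du‖ < 1`. This file checks the vendored implication on
that family, hypotheses **and** conclusion, from theorems of the tree:

* `Minkowski.gradient_eq_zero_of_far`, `Minkowski.fderiv_gradient_eq_zero_of_far` — outside the
  unit ball `∇u` and `∇∇u` vanish when `u` does;
* `hCoeff_trivialAFEnd_eq_of_graph`, `kCoeff_trivialAFEnd_eq_of_graph` — hence the graph data
  `(δ − du ⊗ du, (1 − ‖∇u‖²)^{-1/2} ∇∇u)` read in the chart of the end `trivialAFEnd` are
  `(δ, 0)` identically;
* `isAsymptoticallyFlat_trivialAFEnd_of_graph`, `hasADMEnergy_zero_trivialAFEnd_of_graph` — so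
  they are asymptotically flat of every order and have ADM energy `0` (all fluxes vanish);
* `positive_mass_rigidity_spacetime_graphFamily` — **main result**: for `u` smooth, supported in
  the unit ball, with `‖du‖ ≤ θ < 1`, the vacuum data of
  `Minkowski.exists_vacuumCauchyDevelopment_graph` (`SpacelikeGraphDevelopment.lean`) satisfy all
  five hypotheses of the fact (dominant energy and source decay because they are vacuum,
  `VacuumDataDominantEnergy.lean`; one end, `isSoleEnd_trivialAFEnd`) and its conclusion.

The case `u = 0` is `positive_mass_rigidity_spacetime_hypotheses_trivialData` /
`…_conclusion_trivialData` (`SpacetimePositiveMassRigidityProofs.lean`). Theorems only; no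
definitions, no named facts.

## References

* R. Beig, P. T. Chruściel, *Killing vectors in asymptotically flat space-times. I.*, J. Math.
  Phys. 37 (1996) 1939–1961, Thm. 4.1 and its proof, §4. [BeigChrusciel1996]
* R. Bartnik, *The mass of an asymptotically flat manifold*, CPAM 39 (1986), Def. 2.1, (4.2).
  [Bartnik1986]
* R. Bartnik, J. Isenberg, *The constraint equations* (2004), §2. [BartnikIsenberg2004]
-/

noncomputable section

open Bundle Set Function Filter Topology InnerProductSpace Manifold Asymptotics
open scoped Manifold ContDiff RealInnerProductSpace Gradient NNReal

namespace Literature.Geometry.Lorentzian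

namespace Minkowski

variable {u : E3 → ℝ}

/-! ### A function vanishing outside the unit ball has vanishing gradient and Hessian there -/

/-- If `u = 0` on `{1 < ‖y‖}` then `∇u(y) = 0` for `1 < ‖y‖` (the set is open). [folklore] -/
theorem gradient_eq_zero_of_far (hfar : ∀ y : E3, 1 < ‖y‖ → u y = 0) {y : E3} (hy : 1 < ‖y‖) :
    ∇ u y = 0 := by
  have hev : u =ᶠ[𝓝 y] fun _ ↦ 0 := by
    filter_upwards [(isOpen_lt continuous_const continuous_norm).mem_nhds hy] with z hz
    exact hfar z hz
  rw [gradient, hev.fderiv_eq, fderiv_fun_const, Pi.zero_apply, map_zero]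

/-- If `u = 0` on `{1 < ‖y‖}` then `d(∇u)_y = 0` for `1 < ‖y‖`. [folklore] -/
theorem fderiv_gradient_eq_zero_of_far (hfar : ∀ y : E3, 1 < ‖y‖ → u y = 0) {y : E3}
    (hy : 1 < ‖y‖) : fderiv ℝ (∇ u) y = 0 := by
  have hev : ∇ u =ᶠ[𝓝 y] fun _ ↦ 0 := by
    filter_upwards [(isOpen_lt continuous_const continuous_norm).mem_nhds hy] with z hz
    exact gradient_eq_zero_of_far hfar hz
  rw [hev.fderiv_eq, fderiv_fun_const, Pi.zero_apply]

end Minkowski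

/-! ### Chart components of graph data supported in the unit ball -/

section Coefficients

open Minkowski

variable {u : E3 → ℝ} {D : InitialDataSet 𝓘(ℝ, E3) Minkowski.slice}

/-- **Outside the support the graph data are the trivial data, read in the chart of
`trivialAFEnd`: `h_ij = δ_ij` everywhere on `E3`.** For a data set on the Minkowski slice with
metric `h_y(v, w) = ⟪v, w⟫ − ⟪∇u(y), v⟫ ⟪∇u(y), w⟫` and `u = 0` outside the unit ball, the chart
components of `h` on the end `trivialAFEnd` (identity chart on `{1 < ‖x‖}`, junk value `δ`
inside) are `δ` at every point (`hCoeff_inclusionAFEnd_apply`, `gradient_eq_zero_of_far`).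
Bartnik 1986, Def. 2.1 (the components `(Φ_* g)_ij`). [cite: Bartnik1986, Def. 2.1] -/
theorem hCoeff_trivialAFEnd_eq_of_graph
    (hh : ∀ (y : slice) (v w : E3), D.h.inner y v w = ⟪v, w⟫ - ⟪∇ u y, v⟫ * ⟪∇ u y, w⟫)
    (hfar : ∀ y : E3, 1 < ‖y‖ → u y = 0) :
    AFEnd.hCoeff trivialAFEnd D = fun _ ↦ (innerSL ℝ (E := E3) : E3 →L[ℝ] E3 →L[ℝ] ℝ) := by
  funext x
  by_cases hx : (1 : ℝ) < ‖x‖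
  · ext v w
    refine (hCoeff_inclusionAFEnd_apply Minkowski.slice 1 one_pos
      (fun x _ ↦ Minkowski.mem_slice x) D hx v w).trans ?_
    rw [hh]
    change ⟪v, w⟫ - ⟪∇ u x, v⟫ * ⟪∇ u x, w⟫ = ⟪v, w⟫
    rw [gradient_eq_zero_of_far hfar hx, inner_zero_left, zero_mul, sub_zero]
  · exact dif_neg hx

/-- **`k_ij = 0` everywhere in the chart of `trivialAFEnd`** for graph data with
`k_y(v, w) = c(y) ⟪d(∇u)_y v, w⟫` and `u = 0` outside the unit ball (the Hessian vanishes on the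
open exterior, `fderiv_gradient_eq_zero_of_far`; junk value `0` inside).
Christodoulou–Klainerman 1993, (1.0.9b). [cite: ChristodoulouKlainerman1993, (1.0.9b)] -/
theorem kCoeff_trivialAFEnd_eq_of_graph {c : E3 → ℝ}
    (hk : ∀ (y : slice) (v w : E3), D.k y v w = c y * ⟪fderiv ℝ (∇ u) y v, w⟫)
    (hfar : ∀ y : E3, 1 < ‖y‖ → u y = 0) :
    AFEnd.kCoeff trivialAFEnd D = fun _ ↦ 0 := by
  funext x
  by_cases hx : (1 : ℝ) < ‖x‖
  · have hx' : trivialAFEnd.R < ‖x‖ := hx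
    rw [AFEnd.kCoeff_of_lt (e := trivialAFEnd) D hx']
    have hk0 : D.k (trivialAFEnd.dataChart ⟨x, hx'⟩) = 0 := by
      ext v w
      rw [hk]
      change c x * ⟪fderiv ℝ (∇ u) x v, w⟫ = 0
      rw [fderiv_gradient_eq_zero_of_far hfar hx, _root_.zero_apply, inner_zero_left, mul_zero]
    ext v w
    rw [pullbackBilin_apply, hk0]
    rfl
  · exact dif_neg hx

/-- **Graph data supported in the unit ball are asymptotically flat of every order** on the end
`trivialAFEnd`: `h − δ` and `k` vanish identically in the chart, so all their iterated
derivatives are `0 = O(‖x‖^{-p})` (`isLittleO_norm_iteratedFDeriv_of_forall_eq_zero`). Bartnik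
1986, Def. 2.1; Bartnik–Isenberg 2004, §2. [cite: Bartnik1986, Def. 2.1] -/
theorem isAsymptoticallyFlat_trivialAFEnd_of_graph {c : E3 → ℝ}
    (hh : ∀ (y : slice) (v w : E3), D.h.inner y v w = ⟪v, w⟫ - ⟪∇ u y, v⟫ * ⟪∇ u y, w⟫)
    (hk : ∀ (y : slice) (v w : E3), D.k y v w = c y * ⟪fderiv ℝ (∇ u) y v, w⟫)
    (hfar : ∀ y : E3, 1 < ‖y‖ → u y = 0) (α : ℝ) :
    trivialAFEnd.IsAsymptoticallyFlat D α := by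
  refine ⟨fun m _ ↦ ?_, fun m _ ↦ ?_⟩
  · refine (isLittleO_norm_iteratedFDeriv_of_forall_eq_zero (fun y ↦ ?_) m _ _).isBigO
    ext v w
    show AFEnd.hCoeff trivialAFEnd D y v w - innerSL ℝ (E := E3) v w = 0
    rw [hCoeff_trivialAFEnd_eq_of_graph hh hfar, sub_self]
  · rw [kCoeff_trivialAFEnd_eq_of_graph hk hfar]
    exact (isLittleO_norm_iteratedFDeriv_of_forall_eq_zero (fun _ ↦ rfl) m _ _).isBigO

/-- **Graph data supported in the unit ball have ADM energy `0`** on `trivialAFEnd`: the chart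
components `h_ij = δ_ij` are constant, so every coordinate derivative `∂ₗ h_ij` and every flux
`E(r)` vanishes. Arnowitt–Deser–Misner 1962; Bartnik 1986, (4.2). [cite: Bartnik1986, (4.2)] -/
theorem hasADMEnergy_zero_trivialAFEnd_of_graph
    (hh : ∀ (y : slice) (v w : E3), D.h.inner y v w = ⟪v, w⟫ - ⟪∇ u y, v⟫ * ⟪∇ u y, w⟫)
    (hfar : ∀ y : E3, 1 < ‖y‖ → u y = 0) :
    trivialAFEnd.HasADMEnergy D 0 := by
  have hP : ∀ l i j x, AFEnd.partialH trivialAFEnd D l i j x = 0 := fun l i j x ↦ by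
    simp [AFEnd.partialH, hCoeff_trivialAFEnd_eq_of_graph hh hfar]
  have hF : AFEnd.admEnergyFlux trivialAFEnd D = fun _ ↦ 0 := funext fun r ↦ by
    simp [AFEnd.admEnergyFlux, hP]
  change Tendsto (AFEnd.admEnergyFlux trivialAFEnd D) atTop (𝓝 0)
  rw [hF]
  exact tendsto_const_nhds

end Coefficients

/-! ### The fact on the family of compactly supported spacelike graphs -/

section Family

open Minkowski

variable {u : E3 → ℝ}

/-- **Both sides of the rigid positive energy theorem hold for compactly supported uniformly
spacelike graph data.** Let `u : ℝ³ → ℝ` be `C^∞`, supported in the unit ball, with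
`‖du‖ ≤ θ < 1`. Then the vacuum data `D = (δ − du ⊗ du, (1 − ‖∇u‖²)^{-1/2} ∇∇u)` on the Minkowski
slice (`exists_vacuumCauchyDevelopment_graph`) satisfy **every hypothesis** of
`positive_mass_rigidity_spacetime` with the end `trivialAFEnd` — the dominant energy condition and
source decay (vacuum data: `IsVacuumConstraintSolution.satisfiesDominantEnergyCondition`,
`hasSourceDecay_of_isVacuumConstraintSolution`), asymptotic flatness of order `1`
(`isAsymptoticallyFlat_trivialAFEnd_of_graph`: outside the support the data are exactly
`(δ, 0)`), one end (`isSoleEnd_trivialAFEnd`) and ADM energy `0`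
(`hasADMEnergy_zero_trivialAFEnd_of_graph`) — **and its conclusion**: they have a Cauchy
development which is Minkowski space-time (the graph `t = u(x)`). So the vendored implication
(Beig–Chruściel 1996, Thm. 4.1, `m = 0`) is verified, not merely non-vacuous, on this
infinite-dimensional family; these are precisely the zero-energy data the theorem says exhaust
the hypotheses (compactly perturbed slices of Minkowski space-time).
[cite: BeigChrusciel1996, Thm. 4.1 and its proof, §4] -/
theorem positive_mass_rigidity_spacetime_graphFamily (hu : ContDiff ℝ ∞ u) {θ : ℝ≥0}
    (hθ : θ < 1) (hb : ∀ y, ‖fderiv ℝ u y‖₊ ≤ θ) (hfar : ∀ y : E3, 1 < ‖y‖ → u y = 0) :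
    ∃ D : InitialDataSet 𝓘(ℝ, E3) slice,
      (∀ (y : slice) (v w : E3), D.h.inner y v w = ⟪v, w⟫ - ⟪∇ u y, v⟫ * ⟪∇ u y, w⟫) ∧
      (∀ [D.metric.HasLeviCivita],
        D.SatisfiesDominantEnergyCondition ∧ trivialAFEnd.IsAsymptoticallyFlat D 1 ∧
        (∃ q₀, HasSourceDecay trivialAFEnd D q₀) ∧ trivialAFEnd.IsSoleEnd ∧
        trivialAFEnd.HasADMEnergy D 0) ∧
      ∃ 𝒟 : CauchyDevelopment D, 𝒟.toSpacetime = spacetime := by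
  obtain ⟨D, hh, hk, hvac, 𝒟, h𝒟⟩ := exists_vacuumCauchyDevelopment_graph hu hθ hb
  refine ⟨D, hh, ?_, 𝒟.toCauchyDevelopment, h𝒟⟩
  intro inst
  exact ⟨hvac.satisfiesDominantEnergyCondition,
    isAsymptoticallyFlat_trivialAFEnd_of_graph (c := fun y ↦ (Real.sqrt (1 - ‖∇ u y‖ ^ 2))⁻¹)
      hh hk hfar 1,
    ⟨1, hasSourceDecay_of_isVacuumConstraintSolution trivialAFEnd hvac one_pos⟩,
    isSoleEnd_trivialAFEnd, hasADMEnergy_zero_trivialAFEnd_of_graph hh hfar⟩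

end Family

end Literature.Geometry.Lorentzian

end
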